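import Literature.MathematicalPhysics.QuantumFieldTheory.GaussianToolkit
import HarnessLib

/-!
# Lebesgue integrals against a Gaussian weight as Gaussian expectations

`GaussianToolkit.lean` identifies Mathlib's non-degenerate centred multivariate Gaussian as a density:
`multivariateGaussian 0 P⁻¹ = Z_P⁻¹ · e^{-½ yᵀPy} dy` on `EuclideanSpace ℝ ι`, `Z_P = gaussZ P ∈ (0, ∞)`
(`multivariateGaussian_inv_eq_withDensity`).  This file turns that measure identity into the identities
between Bochner integrals that lattice field theory uses to pass from "functional integrals with a
Gaussian factor" to "Gaussian expectations" — the normal form `∫ e^{-½ yᵀPy} G(y) dy = Z_P · 𝔼_{N(0,P⁻¹)}[G]`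
in which finite-range / multiscale decompositions of the covariance `P⁻¹` act:

* `integral_multivariateGaussian_inv_eq` — `∫ G dN(0,P⁻¹) = Z_P⁻¹ ∫ e^{-½ yᵀPy} G(y) dy`
  (Euclidean-space form; no integrability hypothesis: both sides vanish together);
* `integral_gaussWeight_smul_eq` — `∫ e^{-½ yᵀPy} G(y) dy = Z_P • ∫ G dN(0,P⁻¹)`;
* `integral_pi_gaussWeight_smul_eq`, `integral_pi_mul_gaussWeight_eq` — the same over the plain
  function space `ι → ℝ` with Lebesgue measure (the form in which unfolded lattice integrals arrive),
  real-scalar `•` and complex `*` versions, and `integral_pi_mul_exp_neg_half_mul_eq` for the weight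
  written `e^{-(β/2) yᵀHy}` with an inverse temperature `β > 0` (precision `P = β • H`);
* `integrable_multivariateGaussian_inv_iff`, `integrable_pi_gaussWeight_smul_iff` — the matching
  transfer of integrability.

Everything is proved; no named fact is introduced.

## References

* J. Glimm, A. Jaffe, *Quantum Physics*, 2nd ed., §9.1 (Gaussian integrals on finite lattices). [folklore form]
* D. Brydges, in: *Les Houches 2008/2010 lectures on the renormalisation group*, §1 (Gaussian
  expectation as the reference measure of the RG). [folklore form]
-/

noncomputable section

open MeasureTheory ProbabilityTheory WithLp
open scoped ENNReal Matrix
open Literature.MathematicalPhysics.QuantumFieldTheory.GaussianToolkit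

namespace Literature.MathematicalPhysics.QuantumFieldTheory

variable {ι : Type*} [Fintype ι] [DecidableEq ι]
variable {E : Type*} [NormedAddCommGroup E] [NormedSpace ℝ E]

/-! ## Euclidean-space forms -/

omit [DecidableEq ι] in
/-- The real value of the Gaussian weight: `(gaussWeight P y).toReal = e^{-½ yᵀPy}`. [folklore] -/
theorem toReal_gaussWeight (P : Matrix ι ι ℝ) (y : EuclideanSpace ℝ ι) :
    (gaussWeight P y).toReal = Real.exp (-(ofLp y ⬝ᵥ P *ᵥ ofLp y) / 2) :=
  ENNReal.toReal_ofReal (Real.exp_nonneg _)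

/-- **Gaussian expectation as a weighted Lebesgue integral**: for a positive definite precision matrix `P`,
`∫ G dN(0, P⁻¹) = Z_P⁻¹ • ∫ e^{-½ yᵀPy} G(y) dy` on `EuclideanSpace ℝ ι`.  No integrability hypothesis is
needed (if `G` is not integrable both sides are `0`). [folklore] -/
theorem integral_multivariateGaussian_inv_eq {P : Matrix ι ι ℝ} (hP : P.PosDef)
    (G : EuclideanSpace ℝ ι → E) :
    ∫ x, G x ∂(multivariateGaussian 0 P⁻¹) =
      (gaussZ P).toReal⁻¹ • ∫ y : EuclideanSpace ℝ ι, Real.exp (-(ofLp y ⬝ᵥ P *ᵥ ofLp y) / 2) • G y := by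
  obtain ⟨hμ, -, -⟩ := multivariateGaussian_inv_eq_withDensity hP
  rw [hμ, integral_smul_measure, integral_withDensity_eq_integral_toReal_smul (measurable_gaussWeight P)
    (Filter.Eventually.of_forall fun _ => ENNReal.ofReal_lt_top), ENNReal.toReal_inv]
  simp only [toReal_gaussWeight]

/-- **Weighted Lebesgue integral as a Gaussian expectation**: for a positive definite precision matrix `P`,
`∫ e^{-½ yᵀPy} G(y) dy = Z_P • ∫ G dN(0, P⁻¹)` on `EuclideanSpace ℝ ι`. [folklore] -/
theorem integral_gaussWeight_smul_eq {P : Matrix ι ι ℝ} (hP : P.PosDef) (G : EuclideanSpace ℝ ι → E) :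
    ∫ y : EuclideanSpace ℝ ι, Real.exp (-(ofLp y ⬝ᵥ P *ᵥ ofLp y) / 2) • G y =
      (gaussZ P).toReal • ∫ x, G x ∂(multivariateGaussian 0 P⁻¹) := by
  obtain ⟨-, hZ0, hZtop⟩ := multivariateGaussian_inv_eq_withDensity hP
  have hZ : (gaussZ P).toReal ≠ 0 := ENNReal.toReal_ne_zero.2 ⟨hZ0, hZtop⟩
  rw [integral_multivariateGaussian_inv_eq hP, smul_smul, mul_inv_cancel₀ hZ, one_smul]

/-- **Transfer of integrability**: `G` is integrable for `N(0, P⁻¹)` iff `e^{-½ yᵀPy} • G` is Lebesgue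
integrable on `EuclideanSpace ℝ ι`. [folklore] -/
theorem integrable_multivariateGaussian_inv_iff {P : Matrix ι ι ℝ} (hP : P.PosDef)
    (G : EuclideanSpace ℝ ι → E) :
    Integrable G (multivariateGaussian 0 P⁻¹) ↔
      Integrable (fun y : EuclideanSpace ℝ ι => Real.exp (-(ofLp y ⬝ᵥ P *ᵥ ofLp y) / 2) • G y) := by
  obtain ⟨hμ, hZ0, hZtop⟩ := multivariateGaussian_inv_eq_withDensity hP
  rw [hμ, integrable_smul_measure (ENNReal.inv_ne_zero.2 hZtop) (ENNReal.inv_ne_top.2 hZ0),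
    integrable_withDensity_iff_integrable_smul' (measurable_gaussWeight P)
      (Filter.Eventually.of_forall fun _ => ENNReal.ofReal_lt_top)]
  simp only [toReal_gaussWeight]

/-! ## Function-space forms (`ι → ℝ` with Lebesgue measure) -/

/-- **Weighted Lebesgue integral over `ι → ℝ` as a Gaussian expectation**:
`∫_{ι → ℝ} e^{-½ yᵀPy} G(y) dy = Z_P • ∫ G(ofLp x) dN(0, P⁻¹)(x)`. [folklore] -/
theorem integral_pi_gaussWeight_smul_eq {P : Matrix ι ι ℝ} (hP : P.PosDef) (G : (ι → ℝ) → E) :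
    ∫ y : ι → ℝ, Real.exp (-(y ⬝ᵥ P *ᵥ y) / 2) • G y =
      (gaussZ P).toReal • ∫ x, G (ofLp x) ∂(multivariateGaussian 0 P⁻¹) := by
  rw [← integral_gaussWeight_smul_eq hP (fun x => G (ofLp x))]
  have h := (EuclideanSpace.volume_preserving_symm_measurableEquiv_toLp ι).integral_comp'
    (fun y : ι → ℝ => Real.exp (-(y ⬝ᵥ P *ᵥ y) / 2) • G y)
  rw [MeasurableEquiv.coe_toLp_symm] at h
  exact h.symm

/-- **Transfer of integrability, function-space form**: `x ↦ G (ofLp x)` is integrable for `N(0, P⁻¹)` iff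
`e^{-½ yᵀPy} • G` is Lebesgue integrable on `ι → ℝ`. [folklore] -/
theorem integrable_pi_gaussWeight_smul_iff {P : Matrix ι ι ℝ} (hP : P.PosDef) (G : (ι → ℝ) → E) :
    Integrable (fun x : EuclideanSpace ℝ ι => G (ofLp x)) (multivariateGaussian 0 P⁻¹) ↔
      Integrable (fun y : ι → ℝ => Real.exp (-(y ⬝ᵥ P *ᵥ y) / 2) • G y) := by
  rw [integrable_multivariateGaussian_inv_iff hP]
  have h := (EuclideanSpace.volume_preserving_symm_measurableEquiv_toLp ι).integrable_comp_emb
    (MeasurableEquiv.measurableEmbedding _) (g := fun y : ι → ℝ => Real.exp (-(y ⬝ᵥ P *ᵥ y) / 2) • G y)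
  rw [MeasurableEquiv.coe_toLp_symm] at h
  exact h

/-- Complex-valued, multiplicative form over `ι → ℝ`:
`∫ G(y) e^{-½ yᵀPy} dy = Z_P · ∫ G(ofLp x) dN(0, P⁻¹)(x)`. [folklore] -/
theorem integral_pi_mul_gaussWeight_eq {P : Matrix ι ι ℝ} (hP : P.PosDef) (G : (ι → ℝ) → ℂ) :
    ∫ y : ι → ℝ, G y * (Real.exp (-(y ⬝ᵥ P *ᵥ y) / 2) : ℂ) =
      ((gaussZ P).toReal : ℂ) * ∫ x, G (ofLp x) ∂(multivariateGaussian 0 P⁻¹) := by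
  have h := integral_pi_gaussWeight_smul_eq hP G
  simp only [Complex.real_smul] at h
  rw [← h]
  refine integral_congr_ae (Filter.Eventually.of_forall fun y => ?_)
  simp only [mul_comm (G y)]

omit [Fintype ι] [DecidableEq ι] in
/-- The quadratic form of a scaled matrix: `yᵀ(βH)y = β · yᵀHy`. [folklore] -/
theorem dotProduct_smul_matrix_mulVec [Fintype ι] (β : ℝ) (H : Matrix ι ι ℝ) (y : ι → ℝ) :
    y ⬝ᵥ (β • H) *ᵥ y = β * (y ⬝ᵥ H *ᵥ y) := by
  rw [Matrix.smul_mulVec, dotProduct_smul, smul_eq_mul]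

/-- **Inverse-temperature form**: for `H` positive definite and `β > 0`,
`∫ G(y) e^{-(β/2) yᵀHy} dy = Z_{βH} · ∫ G(ofLp x) dN(0, (βH)⁻¹)(x)` — the Gaussian reference measure of
precision `βH`, i.e. covariance `β⁻¹H⁻¹`. [folklore] -/
theorem integral_pi_mul_exp_neg_half_mul_eq {H : Matrix ι ι ℝ} (hH : H.PosDef) {β : ℝ} (hβ : 0 < β)
    (G : (ι → ℝ) → ℂ) :
    ∫ y : ι → ℝ, G y * (Real.exp (-(β / 2) * (y ⬝ᵥ H *ᵥ y)) : ℂ) =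
      ((gaussZ (β • H)).toReal : ℂ) * ∫ x, G (ofLp x) ∂(multivariateGaussian 0 (β • H)⁻¹) := by
  rw [← integral_pi_mul_gaussWeight_eq (hH.smul hβ) G]
  refine integral_congr_ae (Filter.Eventually.of_forall fun y => ?_)
  simp only [dotProduct_smul_matrix_mulVec]
  congr 3
  ring

/-- The normalising constant in the inverse-temperature form is positive. [folklore] -/
theorem gaussZ_smul_toReal_pos {H : Matrix ι ι ℝ} (hH : H.PosDef) {β : ℝ} (hβ : 0 < β) :
    0 < (gaussZ (β • H)).toReal := by
  obtain ⟨-, hZ0, hZtop⟩ := multivariateGaussian_inv_eq_withDensity (hH.smul hβ)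
  exact ENNReal.toReal_pos hZ0 hZtop

end Literature.MathematicalPhysics.QuantumFieldTheory
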